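import Summits.HubbardSuperconductivity.HubbardSuperconductivity.Theorems.AnisotropyChordTransferFibre3N1RowJUFactor

/-!
# Route `AnisotropyChord` / H0 rotor rung: PORT PartN41-F — `N1RowJUFactor`, PROOFS (1/3): dictionary, site identity, JU closed sums, `TrialGapFromReduced` from the factor, `N1RedFromPieces`

Port (verbatim; split into ≤ 400-line proof files per the tree lint) of §6 of the theory seat's file
`hubbard-h0-rotor-theory-1/cycle23/lean/PartN41F.lean` (sha16 `3f6ed68bc89a1b85`; theory-1 g23 RESULT 2, memo 23 §350):
theory's own proofs, rc 0, no sorry; statements in `…Fibre3N1RowJUFactor`.  Ported by prover seat `hubbard-h0-rotor-p1` g29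
(route lead); `--supports stmt-HubbardSuperconductivity-23918`.  WHAT THIS IS NOT: nothing here proves superconductivity in the
Hubbard model; identities of ONE row of ONE conditional reduction (piece A of the H0-rotor rung).
-/

set_option linter.dupNamespace false
set_option autoImplicit false

noncomputable section

open scoped BigOperators
open Complex Finset

namespace Summit.HubbardSuperconductivity.HubbardSuperconductivity.Theorems.AnisotropyChord.Transfer.Fibre3

namespace N41F

variable (L : ℕ) [NeZero L]

/-! ## §6 PROOFS (no sorry): `DictionaryNu`, the site identity `s = c_sG̃ − a/V`, `TailsViaGreen`, `F2NuSplit`, `PhiHatNuSplit`,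
`JUClosedSums`, `FSrClosures`, `ObjectsNuSplit` (P/A/B by expanding `(j + λ₂S)ⁿ` under `Σ_k`; `Q`, `B_C` by the component
identities `q_integrand`/`bc_integrand` with `|z|² = 1`, the `e`-sum via `nnList_map_sum`, `Re(z̄ₖ z_{k+K₁}) = Re φ(K₁,e)`),
`N1RowJUFactor` (substitution into `N1Identity` + `G2OneLoopForm` + `sum_piR_C0fn`, `‖Π⁰‖² > 0` from `ip_prodState_self_pos`),
`TrialGapFromReduced`, `N1RedFromPieces`. -/

/-- `DictionaryNu` holds (from `ManifoldA.manifold_dictionary`). -/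
theorem dictionaryNu_holds (Δ : ℝ) : DictionaryNu L Δ := by
  intro lam2 f hL hΔ0 hΔ1 hf
  obtain ⟨h1, h2, h3, -, h5, -, -⟩ := ManifoldA.manifold_dictionary L hL hΔ0 hΔ1 hf
  have hL0 : (0 : ℝ) < L := by exact_mod_cast (show 0 < L by omega)
  have hV : (0 : ℝ) < (L : ℝ) ^ 2 := by positivity
  have hη : etaEff L lam2 = (L : ℝ) ^ 2 * lam2 / 4 := rfl
  refine ⟨?_, ?_, ?_, ?_, ?_⟩
  · unfold aPar; linarith
  · rw [h2, hη]; unfold aPar; field_simp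
  · unfold sigPar aPar
    have : cS L Δ lam2 f = lam2 * ((L : ℝ) ^ 2 + Δ * f (K1 L)) := by rw [h2, hη]; field_simp
    rw [← this, h5]
  · rw [h3, hη]; unfold aPar; ring
  · unfold bPar sigPar aPar; ring

/-- `TailsViaGreen` (1): `s(r) = c_s G̃(r) − a/V` at EVERY site (`ground_profile_aKer`, `cS_mul_Gres_zero`). -/
theorem sfun'_eq_green {Δ lam2 : ℝ} {f : Tor L → ℝ} (hL : 5 ≤ L) (hΔ0 : 0 ≤ Δ) (hΔ1 : Δ < 1)
    (hf : IsGroundTwoMagnon L Δ lam2 f) (r : Tor L) :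
    sfun' L Δ f r = cS L Δ lam2 f * Gres L lam2 r - aPar L Δ f / (L : ℝ) ^ 2 := by
  have hc := cS_mul_Gres_zero L hL hΔ0 hΔ1 hf
  unfold sfun' aPar
  by_cases hr : r = 0
  · subst hr; simp only [if_true]; linarith
  · simp only [hr, if_false]
    have hp := ground_profile_aKer L hL hΔ0 hΔ1 hf hr
    unfold aKer at hp
    rw [hp]; linear_combination (-1 : ℝ) * hc

omit [NeZero L] in
/-- `j(k)` as a two-valued function. -/
theorem jK_eq (Δ : ℝ) (f : Tor L → ℝ) (k : Tor L) :
    jK L Δ f k = if k = 0 then Jb L Δ f else -(aPar L Δ f ^ 2) := by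
  unfold jK Jb; split_ifs <;> ring

/-- a torus sum of a function that is constant off the origin. -/
theorem sum_origin_else (x y : ℝ) :
    (∑ k : Tor L, (if k = 0 then x else y)) = x + ((L : ℝ) ^ 2 - 1) * y := by
  rw [← Finset.add_sum_erase _ _ (Finset.mem_univ (0 : Tor L))]
  simp only [if_true]
  congr 1
  rw [Finset.sum_congr rfl (fun k hk => by rw [if_neg (Finset.ne_of_mem_erase hk)] : ∀ k ∈ (Finset.univ : Finset (Tor L)).erase 0,
    (if k = 0 then x else y) = y)]
  exact ClosedExp.sum_erase_zero_const L y

/-- `JUClosedSums` holds (finite trigonometric sums + `ring`). -/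
theorem juClosedSums_holds (Δ : ℝ) : JUClosedSums L Δ := by
  intro f hL
  have hL0 : (0 : ℝ) < L := by exact_mod_cast (show 0 < L by omega)
  have hV : (0 : ℝ) < (L : ℝ) ^ 2 := by positivity
  have hV0 : (L : ℝ) ^ 2 ≠ 0 := hV.ne'
  have hK : K1 L ≠ 0 := K1_ne_zero L (by omega)
  have hcos := ClosedExp.sum_cos_kx_eq_zero L (by omega)
  -- abbreviations
  set a := aPar L Δ f with ha
  set J := Jb L Δ f with hJ
  have hj : ∀ k : Tor L, jK L Δ f k = if k = 0 then J else -(a ^ 2) := fun k => jK_eq L Δ f k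
  -- (1) Σ j³
  have s3 : (∑ k : Tor L, jK L Δ f k ^ 3) = J ^ 3 + ((L : ℝ) ^ 2 - 1) * (-(a ^ 2)) ^ 3 := by
    rw [← sum_origin_else L]
    refine Finset.sum_congr rfl (fun k _ => ?_)
    rw [hj k]; split_ifs <;> rfl
  -- (4) Σ j
  have s1 : (∑ k : Tor L, jK L Δ f k) = J + ((L : ℝ) ^ 2 - 1) * (-(a ^ 2)) := by
    rw [← sum_origin_else L]
    exact Finset.sum_congr rfl (fun k _ => hj k)
  -- (2),(5): cos-weighted sums; write j = −a² + (if k = 0 then J + a² else 0)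
  have hsplit : ∀ k : Tor L, ∀ x y : ℝ, (if k = 0 then x else y) * Real.cos (2 * Real.pi * k.1.val / L)
      = y * Real.cos (2 * Real.pi * k.1.val / L) + (if k = 0 then (x - y) else 0) := by
    intro k x y
    by_cases hk : k = 0
    · subst hk; simp
    · simp [hk]
  have cos_sum : ∀ x y : ℝ, (∑ k : Tor L, (if k = 0 then x else y) * Real.cos (2 * Real.pi * k.1.val / L)) = x - y := by
    intro x y
    rw [Finset.sum_congr rfl (fun k _ => hsplit k x y), Finset.sum_add_distrib, ← Finset.mul_sum, hcos, mul_zero, zero_add,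
      Finset.sum_ite_eq' Finset.univ (0 : Tor L) (fun _ => x - y)]
    simp
  have s2 : (∑ k : Tor L, jK L Δ f k ^ 2 * Real.cos (2 * Real.pi * k.1.val / L)) = J ^ 2 - a ^ 4 := by
    have : ∀ k : Tor L, jK L Δ f k ^ 2 = if k = 0 then J ^ 2 else a ^ 4 := by
      intro k; rw [hj k]; split_ifs <;> ring
    rw [Finset.sum_congr rfl (fun k _ => by rw [this k]), cos_sum]
  have s5 : (∑ k : Tor L, jK L Δ f k * Real.cos (2 * Real.pi * k.1.val / L)) = J + a ^ 2 := by
    rw [Finset.sum_congr rfl (fun k _ => by rw [hj k]), cos_sum]; ring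
  -- (3) Σ j(k)² j(k + K₁): split off k = 0 and k = −K₁
  have hneg : -K1 L ≠ 0 := neg_ne_zero.2 hK
  have sB : (∑ k : Tor L, jK L Δ f k ^ 2 * jK L Δ f (k + K1 L))
      = J ^ 2 * (-(a ^ 2)) + a ^ 4 * J + ((L : ℝ) ^ 2 - 2) * (a ^ 4 * (-(a ^ 2))) := by
    have hT := ClosedExp.sum_torPrime L (by omega) (fun k => jK L Δ f k ^ 2 * jK L Δ f (k + K1 L))
    have hconst : ∀ k ∈ torPrime L, jK L Δ f k ^ 2 * jK L Δ f (k + K1 L) = a ^ 4 * (-(a ^ 2)) := by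
      intro k hk
      rw [ClosedExp.torPrime_eq] at hk
      have hk0 : k ≠ 0 := Finset.ne_of_mem_erase (Finset.mem_of_mem_erase hk)
      have hk1 : k + K1 L ≠ 0 := by
        intro h; exact (Finset.ne_of_mem_erase hk) (eq_neg_of_add_eq_zero_left h)
      rw [hj k, hj (k + K1 L), if_neg hk0, if_neg hk1]; ring
    have hcard : (∑ k ∈ torPrime L, jK L Δ f k ^ 2 * jK L Δ f (k + K1 L)) = ((L : ℝ) ^ 2 - 2) * (a ^ 4 * (-(a ^ 2))) := by
      rw [Finset.sum_congr rfl hconst, Finset.sum_const, nsmul_eq_mul]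
      congr 1
      rw [ClosedExp.torPrime_eq, Finset.card_erase_of_mem, Finset.card_erase_of_mem (Finset.mem_univ _), Finset.card_univ,
        Fintype.card_prod, ZMod.card]
      · have h1 : 1 ≤ L * L := by nlinarith
        have h2 : 2 ≤ L * L := by nlinarith
        push_cast [Nat.sub_sub, h2]
        ring
      · exact Finset.mem_erase.2 ⟨hneg, Finset.mem_univ _⟩
    have h0 : jK L Δ f 0 ^ 2 * jK L Δ f (0 + K1 L) = J ^ 2 * (-(a ^ 2)) := by
      rw [zero_add, hj 0, hj (K1 L), if_pos rfl, if_neg hK]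
    have h1 : jK L Δ f (-K1 L) ^ 2 * jK L Δ f (-K1 L + K1 L) = a ^ 4 * J := by
      rw [neg_add_cancel, hj (-K1 L), hj 0, if_neg hneg, if_pos rfl]; ring
    linarith [hT, hcard, h0, h1]
  refine ⟨?_, ?_, ?_, ?_, ?_, ?_, ?_⟩
  · rw [s3]; unfold PJU; ring
  · rw [s2, hJ, ha]; unfold AJU; rfl
  · rw [sB]; unfold BJU; ring
  · rw [s1, hJ]; unfold Jb; field_simp; ring
  · rw [s5, hJ]; unfold Jb; field_simp; ring
  · unfold bPar sigPar; ring
  · unfold BJU AJU Jb bPar sigPar; field_simp; ring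

/-- `N1RowJUFactor ⇒ TrialGapFromReduced` (`λ₂ > 0` by `lam2_pos`). -/
theorem trialGapFromReduced_of_factor (Δ c : ℝ) (hF : N1RowJUFactor L Δ) : TrialGapFromReduced L Δ c := by
  intro hL hΔ0 hΔ1 hred
  unfold TrialGapAbs
  intro lam2 f hf
  obtain ⟨-, hU, hN⟩ := hF lam2 f hL hΔ0 hΔ1 hf
  have hl : 0 < lam2 := lam2_pos L (by omega) hΔ1 hf.1
  have h := hred lam2 f hf
  rw [hU, hN]
  calc c * (lam2 * Ured L Δ lam2 f) = lam2 * (c * Ured L Δ lam2 f) := by ring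
    _ ≤ lam2 * N1red L Δ lam2 f := mul_le_mul_of_nonneg_left h hl.le

/-- `N1RedFromPieces` holds (monotonicity; `ε₁ ≥ 0`, `a ≥ 0`). -/
theorem n1RedFromPieces_holds (Δ : ℝ) : N1RedFromPieces L Δ := by
  intro lam2 f hL hΔ0 hΔ1 hf Jlo BShi AShi Ahi Mlo Phi Clo hJ hB hA ha hAx hM hP hC
  have he : 0 ≤ eps1 L := by unfold eps1; linarith [Real.cos_le_one (2 * Real.pi / L)]
  have hV : (0 : ℝ) ≤ (L : ℝ) ^ 2 := by positivity
  unfold N1red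
  have t1 : eps1 L * BSr L Δ lam2 f ≤ eps1 L * BShi := mul_le_mul_of_nonneg_left hB he
  have t2 : eps1 L * (aPar L Δ f ^ 2 * ASr L Δ lam2 f) ≤ eps1 L * (aPar L Δ f ^ 2 * AShi) :=
    mul_le_mul_of_nonneg_left (mul_le_mul_of_nonneg_left hA (sq_nonneg _)) he
  have t3 : eps1 L * aPar L Δ f * (L : ℝ) ^ 2 * Axhat L f ≤ eps1 L * aPar L Δ f * (L : ℝ) ^ 2 * Ahi :=
    mul_le_mul_of_nonneg_left hAx (mul_nonneg (mul_nonneg he ha) hV)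
  have t4 : eps1 L * PiNormSq L f ≤ eps1 L * Phi := mul_le_mul_of_nonneg_left hP he
  linarith


end N41F

end Summit.HubbardSuperconductivity.HubbardSuperconductivity.Theorems.AnisotropyChord.Transfer.Fibre3

end
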